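import Summits.QuantumAdvantage.QuantumAdvantage.Theorems.NearExactIsExact.Negative.ConcatDefect
import Literature.Computability.QuantumComplexity.SignedForrelationGadget

/-!
# `NearExactIsExact` (stmt-QuantumAdvantage-14043) — negative-side tool (disprove, gen 21):
  the HYPERPLANE TEST — a dual-free ceiling for a cubic bent function from ONE restriction

Let `g` be bent on `n + 1` bits (Walsh spectrum `± √(2^{n+1})`, Boolean dual `d`), and let
`g₀ = g(· ‖ 0)`, `g₁ = g(· ‖ 1)` be its restrictions to the coordinate hyperplane `{z_n = 0}` and its
complement.  The Walsh slicing identity `W_g(u ‖ a) = W_{g₀}(u) + (-1)^a W_{g₁}(u)` (`hs_W_append`) gives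
A. Canteaut and P. Charpin's decomposition fact (Decomposing bent functions, IEEE Trans. Inform. Theory 49
(2003) 2004–2019, §V): the restrictions are near-bent with COMPLEMENTARY Walsh supports, and the support of
`W_{g₀}` is read off the dual — `d(u ‖ 0) ≠ d(u ‖ 1) ↔ W_{g₀}(u) = 0` (`hs_dual_slice`).  In words: the
derivative of the dual along the last coordinate is the indicator `h` of the Walsh-NULL set of `g₀`.

Consequence (`hs_core`, `hs_forrelation_le_mul`; the one-coordinate analogue of `ConcatDefect.cd_core`, which
needs a 4-piece concatenation with KNOWN duals): for every cubic `f` on `n + 1` bits the slice derivative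
`q = f(·‖0) ⊕ f(·‖1)` is quadratic and `#{u : h u ≠ q u} ≤ #{z : f z ≠ d z}`, hence

  `Φ(f, g) = 1 − 2·#{f ≠ d}/2^{n+1} ≤ 1 − dist(h, RM(2,n))/2ⁿ`        (THE HYPERPLANE TEST).

So a cubic bent function can score `Φ > 1 − t/2ⁿ` against a cubic partner only if, along EVERY coordinate
hyperplane (and, after a linear change of variables, every hyperplane), the Walsh-null set of the restriction is
`t`-close to a quadric; exactness (`Φ = 1`) needs every such null set to BE a quadric (`hs_quadric_of_exact`).
Certificate corollaries: if `h` has degree `≤ 3` but is not quadratic, `Φ(f, g) ≤ 7/8` for all cubic `f`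
(`hs_le_seven_eighths`); degree `≤ 4` and not quadratic, `Φ ≤ 15/16` (`hs_le_fifteen_sixteenths`).  The test is
DUAL-FREE: it needs the Walsh transform of one `n`-bit restriction and one Reed–Muller membership, not the
`(n+1)`-bit dual and its distance to `RM(3, n+1)`.

Use in the cell (DISPROOF.md §28, HOME `run/shared/lean/b2b/cubic-forrelation/`): the cubic almost-bent
components `Tr(x^13)` (Kasami) and `Tr(x^{2^t+3})` (Welch) on `𝔽_{2^N}`, `N = 9, 11, 13, 15`, have Walsh
supports of algebraic degree `3, 3, 4, 4` at relative distance `≥ 1/8` from `RM(2,N)`; by the hyperplane test NO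
cubic bent function on `N + 1` bits having one of them as a hyperplane restriction reaches `Φ > 7/8` — the
"AB-halves" habitat is closed for the window `(15/16, 1)` before any partner search.
HONEST FRAMING: a structural tool / no-go for one habitat of the crux (value = theorem), NOT summit progress; it
neither proves nor refutes `NearExactIsExact`.  Everything is proved from the tree (`stub_derivDegree`,
`stub_rmWeight`, `acx_deg_eval`, `cd_forrelation_eq_of_dual`, `SgnForrMem.signOf_false/true`); standard axioms. [folklore]
-/

set_option linter.dupNamespace false -- D-0017: single-problem summit ⇒ `QuantumAdvantage.QuantumAdvantage` by design

noncomputable section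

namespace Summit.QuantumAdvantage.QuantumAdvantage.Theorems.NearExactIsExact.Negative.HyperplaneSupport

open Finset
open Literature.Computability.QuantumComplexity
open Literature.Computability.QuantumComplexity.BuzetChailloux (bxor zeroVec)
open Literature.Computability.QuantumComplexity.DerivativeWalsh (W)
open Literature.Computability.QuantumComplexity.SgnForrMem (signOf_false signOf_true)
open Summit.QuantumAdvantage.QuantumAdvantage.Theorems.CubicForrelation.NearExactIsExact
  (bb_isDegLeFun_bxor acx_deg_eval acx_deg_mono acx_bxor_append_zero stub_rmWeight stub_derivDegree)
open Summit.QuantumAdvantage.QuantumAdvantage.Theorems.NearExactIsExact.Negative.ConcatDefect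
  (cd_forrelation_eq_of_dual)

variable {n : ℕ}

/-! ### One appended coordinate: sums, twists, counting -/

/-- `(-1)^a + (-1)^b = 0` exactly when `a ≠ b`. -/
theorem hs_signOf_add_eq_zero_iff (a b : Bool) : signOf a + signOf b = 0 ↔ a ≠ b := by
  cases a <;> cases b <;> norm_num [signOf]

/-- A sum over `Fin 1 → Bool` has the two terms `v ≡ 0` and `v ≡ 1`. -/
theorem hs_sum_fin_one {M : Type*} [AddCommMonoid M] (H : (Fin 1 → Bool) → M) :
    ∑ v, H v = H (fun _ => false) + H (fun _ => true) := by
  have hu : (univ : Finset (Fin 1 → Bool)) = {(fun _ => false), (fun _ => true)} := by decide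
  rw [hu, sum_pair]
  exact fun h => Bool.false_ne_true (congrFun h 0)

/-- The twist on one coordinate. -/
theorem hs_twist_fin_one (a c : Bool) :
    twist (fun _ : Fin 1 => a) (fun _ : Fin 1 => c) = if (a && c) = true then (-1 : ℝ) else 1 := by
  unfold twist
  rw [Fin.prod_univ_one]

/-- Fibre decomposition of a count on `n + 1` bits along the last coordinate. -/
theorem hs_card_split (P : (Fin (n + 1) → Bool) → Prop) [DecidablePred P] :
    (univ.filter P).card =
      (univ.filter fun u : Fin n → Bool => P (Fin.append u fun _ => false)).card +
        (univ.filter fun u : Fin n → Bool => P (Fin.append u fun _ => true)).card := by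
  have h : (univ.filter P).card =
      ∑ ξ : Fin 1 → Bool, (univ.filter fun u : Fin n → Bool => P (Fin.append u ξ)).card := by
    simp only [card_filter]
    rw [← (Fin.appendEquiv n 1).sum_comp, Fintype.sum_prod_type, sum_comm]
    rfl
  rw [h, hs_sum_fin_one]

/-! ### Walsh slicing and the dual along a hyperplane (Canteaut–Charpin) -/

/-- **Walsh slicing.** `W_g(u ‖ a) = W_{g(·‖0)}(u) + (-1)^a · W_{g(·‖1)}(u)` for every Boolean `g` on
`n + 1` bits. [folklore] -/
theorem hs_W_append (g : (Fin (n + 1) → Bool) → Bool) (u : Fin n → Bool) (a : Bool) :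
    W (fun y => signOf (g y)) (Fin.append u fun _ => a) =
      W (fun y => signOf (g (Fin.append y fun _ => false))) u +
        signOf a * W (fun y => signOf (g (Fin.append y fun _ => true))) u := by
  unfold W
  rw [sum_append, mul_sum, ← sum_add_distrib]
  refine sum_congr rfl fun y _ => ?_
  rw [hs_sum_fin_one, twist_append, twist_append, hs_twist_fin_one, hs_twist_fin_one]
  cases a <;> simp [signOf_false, signOf_true]

/-- **The dual along a hyperplane** (Canteaut–Charpin 2003, §V): if `W_g = K·(-1)^d` pointwise with
`K ≠ 0`, then `d(u ‖ 0) ≠ d(u ‖ 1)` exactly when `W_{g(·‖0)}(u) = 0` — the derivative of the dual along the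
last coordinate is the indicator of the Walsh-null set of the restriction. [folklore] -/
theorem hs_dual_slice {g d : (Fin (n + 1) → Bool) → Bool} {K : ℝ} (hK : K ≠ 0)
    (hd : ∀ z, W (fun y => signOf (g y)) z = K * signOf (d z)) (u : Fin n → Bool) :
    d (Fin.append u fun _ => false) ≠ d (Fin.append u fun _ => true) ↔
      W (fun y => signOf (g (Fin.append y fun _ => false))) u = 0 := by
  have h0 := hd (Fin.append u fun _ => false)
  have h1 := hd (Fin.append u fun _ => true)
  rw [hs_W_append, signOf_false, one_mul] at h0
  rw [hs_W_append, signOf_true, neg_one_mul] at h1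
  have hA : 2 * W (fun y => signOf (g (Fin.append y fun _ => false))) u =
      K * (signOf (d (Fin.append u fun _ => false)) + signOf (d (Fin.append u fun _ => true))) := by
    linear_combination h0 + h1
  generalize W (fun y => signOf (g (Fin.append y fun _ => false))) u = A at hA
  rw [← hs_signOf_add_eq_zero_iff]
  constructor
  · intro hab
    have h2 : 2 * A = 0 := by rw [hA, hab, mul_zero]
    linarith
  · intro hA0
    have hz : K * (signOf (d (Fin.append u fun _ => false)) + signOf (d (Fin.append u fun _ => true))) = 0 := by
      rw [← hA, hA0, mul_zero]
    rcases mul_eq_zero.1 hz with hz | hz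
    · exact absurd hz hK
    · exact hz

/-! ### The coding half: one-coordinate analogue of `ConcatDefect.cd_core` -/

/-- **Core counting lemma (one coordinate).** Let `f` be cubic on `n + 1` bits and let `D` be ANY Boolean
function whose two slices differ by `h`: `D(u‖0) ⊕ D(u‖1) = h(u)`.  Then the quadratic
`q = f(·‖0) ⊕ f(·‖1)` has `#{u : h u ≠ q u} ≤ #{z : f z ≠ D z}`; so `f` misses `D` in at least
`dist(h, RM(2,n))` points. [folklore] -/
theorem hs_core (f D : (Fin (n + 1) → Bool) → Bool) (h : (Fin n → Bool) → Bool) (hf : IsDegLeFun 3 f)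
    (hD : ∀ u, h u = (D (Fin.append u fun _ => false) ^^ D (Fin.append u fun _ => true))) :
    ∃ q : (Fin n → Bool) → Bool, IsDegLeFun 2 q ∧
      (univ.filter fun u => h u ≠ q u).card ≤ (univ.filter fun z => f z ≠ D z).card := by
  refine ⟨fun u => f (Fin.append u fun _ => false) ^^ f (Fin.append u fun _ => true), ?_, ?_⟩
  · have hderiv : IsDegLeFun 2 (fun z : Fin (n + 1) → Bool =>
        f z ^^ f (bxor z (Fin.append zeroVec fun _ : Fin 1 => true))) :=
      stub_derivDegree (n + 1) 2 f _ hf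
    have h1 := acx_deg_eval (F := fun z : Fin (n + 1) → Bool =>
        f z ^^ f (bxor z (Fin.append zeroVec fun _ : Fin 1 => true))) hderiv (fun _ => false)
    have e : ∀ u : Fin n → Bool,
        bxor (Fin.append u fun _ : Fin 1 => false) (Fin.append zeroVec fun _ : Fin 1 => true) =
          Fin.append u fun _ => true := fun u => by
      rw [acx_bxor_append_zero]
      rfl
    simp only [e] at h1
    exact h1
  · rw [hs_card_split (fun z => f z ≠ D z)]
    refine (card_le_card ?_).trans (card_union_le _ _)
    intro u hu
    simp only [mem_filter, mem_univ, true_and] at hu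
    rw [mem_union, mem_filter, mem_filter]
    simp only [mem_univ, true_and]
    by_contra hcon
    apply hu
    have h0 : f (Fin.append u fun _ => false) = D (Fin.append u fun _ => false) := by
      by_contra h0
      exact hcon (Or.inl h0)
    have h1 : f (Fin.append u fun _ => true) = D (Fin.append u fun _ => true) := by
      by_contra h1
      exact hcon (Or.inr h1)
    rw [h0, h1]
    exact hD u

/-- `{u : (h ⊕ q)(u) = 1} = {u : h u ≠ q u}`. -/
theorem hs_filter_bxor_eq (h q : (Fin n → Bool) → Bool) :
    (univ.filter fun u => (h u ^^ q u) = true) = univ.filter fun u => h u ≠ q u :=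
  filter_congr fun u _ => by cases h u <;> cases q u <;> decide

/-- If `h` has degree `≤ e + 1`... concretely: if `h` has degree `≤ r` (`r = 3` or `4` below) and is NOT
quadratic, then `2ⁿ ≤ 2^r · #{u : h u ≠ q u}` for every quadratic `q` (the word `h ⊕ q` is a nonzero word of
`RM(r,n)`; Reed–Muller minimum weight `stub_rmWeight`). [folklore] -/
theorem hs_pow_mul_card_of_not_quadratic {r : ℕ} (hr : 2 ≤ r) (h : (Fin n → Bool) → Bool)
    (hhr : IsDegLeFun r h) (hh2 : ¬ IsDegLeFun 2 h) :
    ∀ q : (Fin n → Bool) → Bool, IsDegLeFun 2 q →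
      2 ^ n ≤ 2 ^ r * (univ.filter fun u => h u ≠ q u).card := by
  intro q hq
  have he : IsDegLeFun r (fun u => h u ^^ q u) := bb_isDegLeFun_bxor hhr (acx_deg_mono hr hq)
  have hne : ∃ u, (h u ^^ q u) = true := by
    by_contra hall
    apply hh2
    have e : h = q := funext fun u => by
      have hu := not_exists.mp hall u
      revert hu
      cases h u <;> cases q u <;> decide
    rw [e]
    exact hq
  have hw := stub_rmWeight stub_derivDegree n r _ he hne
  rwa [hs_filter_bxor_eq] at hw

/-! ### The hyperplane test -/

/-- From an `↔`-description of the null set and of the dual derivative to the Boolean slice equation. -/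
theorem hs_eq_xor_of_iff {a b c : Bool} {P : Prop} (h1 : a ≠ b ↔ P) (h2 : c = true ↔ P) :
    c = (a ^^ b) := by
  cases a <;> cases b <;> cases c <;> simp_all

/-- **THE HYPERPLANE TEST (weighted form).** Let `g` be bent on `n + 1` bits with dual `d`
(`W_g = √(2^{n+1})·(-1)^d`), let `h` be the indicator of the Walsh-null set of the restriction `g(·‖0)`, and
suppose `T ≤ k·#{u : h u ≠ q u}` for every quadratic `q` (`k = 1`, `T = dist(h, RM(2,n))`; or `k = 2^r`,
`T = 2ⁿ` when `h ∈ RM(r,n) ∖ RM(2,n)`).  Then `Φ(f, g) ≤ 1 − T/(k·2ⁿ)` for EVERY cubic `f`. -/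
theorem hs_forrelation_le_mul (f g d : (Fin (n + 1) → Bool) → Bool) (h : (Fin n → Bool) → Bool) (k T : ℕ)
    (hk : 0 < k) (hf : IsDegLeFun 3 f)
    (hd : ∀ z, W (fun y => signOf (g y)) z = Real.sqrt ((2 : ℝ) ^ (n + 1)) * signOf (d z))
    (hh : ∀ u, h u = true ↔ W (fun y => signOf (g (Fin.append y fun _ => false))) u = 0)
    (hT : ∀ q : (Fin n → Bool) → Bool, IsDegLeFun 2 q → T ≤ k * (univ.filter fun u => h u ≠ q u).card) :
    forrelation f g ≤ 1 - (T : ℝ) / ((k : ℝ) * 2 ^ n) := by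
  have hK : Real.sqrt ((2 : ℝ) ^ (n + 1)) ≠ 0 := (Real.sqrt_pos.2 (by positivity)).ne'
  have hD : ∀ u, h u = (d (Fin.append u fun _ => false) ^^ d (Fin.append u fun _ => true)) :=
    fun u => hs_eq_xor_of_iff (hs_dual_slice hK hd u) (hh u)
  obtain ⟨q, hq, hle⟩ := hs_core f d h hf hD
  have hTC : T ≤ k * (univ.filter fun z => f z ≠ d z).card :=
    (hT q hq).trans (Nat.mul_le_mul_left k hle)
  have hTC' : (T : ℝ) ≤ (k : ℝ) * ((univ.filter fun z => f z ≠ d z).card : ℝ) := by exact_mod_cast hTC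
  rw [cd_forrelation_eq_of_dual f g d hd, pow_succ]
  have h2n : (0 : ℝ) < (2 : ℝ) ^ n := by positivity
  have hk' : (0 : ℝ) < (k : ℝ) := by exact_mod_cast hk
  have e : 2 * ((univ.filter fun z => f z ≠ d z).card : ℝ) / (2 ^ n * 2) =
      ((univ.filter fun z => f z ≠ d z).card : ℝ) / 2 ^ n := by
    field_simp
  rw [sub_le_sub_iff_left, e, ← div_div]
  gcongr
  rw [div_le_iff₀ hk']
  linarith

/-- **THE HYPERPLANE TEST.** With `L ≤ dist(h, RM(2,n))` (`h` the Walsh-null indicator of the restriction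
`g(·‖0)` of a bent `g` on `n + 1` bits): `Φ(f, g) ≤ 1 − L/2ⁿ` for every cubic `f`. -/
theorem hs_forrelation_le (f g d : (Fin (n + 1) → Bool) → Bool) (h : (Fin n → Bool) → Bool) (L : ℕ)
    (hf : IsDegLeFun 3 f)
    (hd : ∀ z, W (fun y => signOf (g y)) z = Real.sqrt ((2 : ℝ) ^ (n + 1)) * signOf (d z))
    (hh : ∀ u, h u = true ↔ W (fun y => signOf (g (Fin.append y fun _ => false))) u = 0)
    (hL : ∀ q : (Fin n → Bool) → Bool, IsDegLeFun 2 q → L ≤ (univ.filter fun u => h u ≠ q u).card) :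
    forrelation f g ≤ 1 - (L : ℝ) / 2 ^ n := by
  have h := hs_forrelation_le_mul f g d h 1 L Nat.one_pos hf hd hh (fun q hq => by simpa using hL q hq)
  simpa using h

/-- **Exactness needs quadric null sets.** If some cubic `f` is an exact partner of the bent `g`
(`Φ(f, g) = 1`), then the Walsh-null indicator `h` of the restriction `g(·‖0)` is quadratic. -/
theorem hs_quadric_of_exact (f g d : (Fin (n + 1) → Bool) → Bool) (h : (Fin n → Bool) → Bool)
    (hf : IsDegLeFun 3 f)
    (hd : ∀ z, W (fun y => signOf (g y)) z = Real.sqrt ((2 : ℝ) ^ (n + 1)) * signOf (d z))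
    (hh : ∀ u, h u = true ↔ W (fun y => signOf (g (Fin.append y fun _ => false))) u = 0)
    (hexact : forrelation f g = 1) : IsDegLeFun 2 h := by
  have hK : Real.sqrt ((2 : ℝ) ^ (n + 1)) ≠ 0 := (Real.sqrt_pos.2 (by positivity)).ne'
  have hD : ∀ u, h u = (d (Fin.append u fun _ => false) ^^ d (Fin.append u fun _ => true)) :=
    fun u => hs_eq_xor_of_iff (hs_dual_slice hK hd u) (hh u)
  obtain ⟨q, hq, hle⟩ := hs_core f d h hf hD
  rw [cd_forrelation_eq_of_dual f g d hd] at hexact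
  have h2 : (0 : ℝ) < (2 : ℝ) ^ (n + 1) := by positivity
  have hC : ((univ.filter fun z => f z ≠ d z).card : ℝ) = 0 := by
    have e : 2 * ((univ.filter fun z => f z ≠ d z).card : ℝ) / 2 ^ (n + 1) = 0 := by linarith
    rw [div_eq_zero_iff] at e
    rcases e with e | e
    · linarith
    · exact absurd e h2.ne'
  have hC0 : (univ.filter fun z => f z ≠ d z).card = 0 := by exact_mod_cast hC
  have hq0 : (univ.filter fun u => h u ≠ q u) = ∅ :=
    card_eq_zero.mp (Nat.le_zero.mp (hle.trans_eq hC0))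
  have e : h = q := funext fun u => not_not.mp (filter_eq_empty_iff.mp hq0 (mem_univ u))
  rw [e]
  exact hq

/-- **`7/8` certificate.** If the Walsh-null indicator `h` of the restriction `g(·‖0)` of a bent `g` on
`n + 1` bits has degree `≤ 3` but is not quadratic, then `Φ(f, g) ≤ 7/8` for every cubic `f`. -/
theorem hs_le_seven_eighths (f g d : (Fin (n + 1) → Bool) → Bool) (h : (Fin n → Bool) → Bool)
    (hf : IsDegLeFun 3 f)
    (hd : ∀ z, W (fun y => signOf (g y)) z = Real.sqrt ((2 : ℝ) ^ (n + 1)) * signOf (d z))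
    (hh : ∀ u, h u = true ↔ W (fun y => signOf (g (Fin.append y fun _ => false))) u = 0)
    (hh3 : IsDegLeFun 3 h) (hh2 : ¬ IsDegLeFun 2 h) : forrelation f g ≤ 7 / 8 := by
  have h := hs_forrelation_le_mul f g d h (2 ^ 3) (2 ^ n) (by norm_num) hf hd hh
    (hs_pow_mul_card_of_not_quadratic (by norm_num) h hh3 hh2)
  have e : ((2 ^ n : ℕ) : ℝ) / (((2 ^ 3 : ℕ) : ℝ) * 2 ^ n) = 1 / 8 := by
    rw [div_eq_div_iff (by positivity) (by norm_num)]
    push_cast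
    ring
  rw [e] at h
  linarith

/-- **`15/16` certificate.** If the Walsh-null indicator `h` of the restriction has degree `≤ 4` but is not
quadratic, then `Φ(f, g) ≤ 15/16` for every cubic `f`. -/
theorem hs_le_fifteen_sixteenths (f g d : (Fin (n + 1) → Bool) → Bool) (h : (Fin n → Bool) → Bool)
    (hf : IsDegLeFun 3 f)
    (hd : ∀ z, W (fun y => signOf (g y)) z = Real.sqrt ((2 : ℝ) ^ (n + 1)) * signOf (d z))
    (hh : ∀ u, h u = true ↔ W (fun y => signOf (g (Fin.append y fun _ => false))) u = 0)
    (hh4 : IsDegLeFun 4 h) (hh2 : ¬ IsDegLeFun 2 h) : forrelation f g ≤ 15 / 16 := by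
  have h := hs_forrelation_le_mul f g d h (2 ^ 4) (2 ^ n) (by norm_num) hf hd hh
    (hs_pow_mul_card_of_not_quadratic (by norm_num) h hh4 hh2)
  have e : ((2 ^ n : ℕ) : ℝ) / (((2 ^ 4 : ℕ) : ℝ) * 2 ^ n) = 1 / 16 := by
    rw [div_eq_div_iff (by positivity) (by norm_num)]
    push_cast
    ring
  rw [e] at h
  linarith

end Summit.QuantumAdvantage.QuantumAdvantage.Theorems.NearExactIsExact.Negative.HyperplaneSupport

end
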